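import Mathlib
import Summits.Ventures.PercRepro2.LocRows
import Summits.Ventures.PercRepro2.LocRows2
import Summits.Ventures.PercRepro2.LocSym
import Summits.Ventures.PercRepro2.LocMono
import Summits.Ventures.PercRepro2.LocMonoTwo

/-!
# The two-sided forbidden-set row implies row (LOC0-mono) (blind cell PercRepro2, night-4 g2)

`locMono_of_locMonoTwo`: `LocMonoTwo ends l o {h} {h}` gives `LocMono ends l h o` (not only `(LOC-𝓤)`):
the sources coincide (`srcTwo_singleton`), and every clause of `LocMono` is a clause of `LocMonoTwo`
except membership in `tgtU`, which follows from the blue-cluster, core and absorption clauses as in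
`locU_of_locMonoTwo`.  With `locU_of_locMono` the Lean ladder of the seat reads
`LocMonoTwo {h} {h} ⟹ LocMono ⟹ LocU ⟹ 2′DOM2 ⟹ (BASE)` (the last two steps `LocUDom2` / `HullDom`).
-/

namespace Summit.Ventures.PercRepro2

namespace LocRows

open Hull

variable {V : Type*} {E : Type*} [Fintype E] [DecidableEq E]

open scoped Classical

variable (ends : E → Sym2 V)

/-- (LOC0-mono-RB) at `Y_R = Y_B = {h}` gives row (LOC0-mono). -/
theorem locMono_of_locMonoTwo (l h o : V) (hm : LocMonoTwo ends l o {h} {h}) :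
    LocMono ends l h o := by
  obtain ⟨f, hf, hmem⟩ := hm
  have hmemsrc : ∀ ζ, ζ ∈ srcU ends l h {S : Set V | o ∈ S} → ζ ∈ srcTwo ends l o {h} {h} := by
    intro ζ hζ; rw [srcTwo_singleton]; exact hζ
  refine ⟨fun y => f ⟨y.1, hmemsrc y.1 y.2⟩, ?_, ?_⟩
  · intro y y' hyy'
    have h1 := hf hyy'
    have h2 : y.1 = y'.1 := Subtype.mk_eq_mk.1 h1
    exact Subtype.ext h2
  · intro y
    obtain ⟨hx, hloc, hmono, hnest, hnorel, habs⟩ := hmem ⟨y.1, hmemsrc y.1 y.2⟩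
    refine ⟨?_, hloc, hmono, hnest, hnorel⟩
    have hsrc := y.2
    simp only [srcU, Finset.mem_filter, Finset.mem_univ, true_and, Set.mem_setOf_eq] at hsrc
    simp only [tgtTwo, Finset.mem_filter, Finset.mem_univ, true_and,
      Set.disjoint_singleton_right] at hx
    obtain ⟨ho, hB, _⟩ := hx
    simp only [tgtU, Finset.mem_filter, Finset.mem_univ, true_and, Set.mem_setOf_eq, hull,
      Set.mem_union, not_or]
    refine ⟨⟨?_, hB⟩, ho.1, ho.2⟩
    intro hR
    have hhB : h ∉ cluster ends (blue y.1) l := fun hh => hsrc.1 (Or.inr hh)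
    exact (Set.disjoint_singleton_right.1 habs) ⟨hR, hhB⟩

end LocRows

end Summit.Ventures.PercRepro2
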